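import Mathlib
import Summits.Ventures.PercRepro2.Defs
import Summits.Ventures.PercRepro2.Independence
import Summits.Ventures.PercRepro2.Harris
import Summits.Ventures.PercRepro2.Graph
import Summits.Ventures.PercRepro2.Exploration
import Summits.Ventures.PercRepro2.Events
import Summits.Ventures.PercRepro2.FourFunctions
import Summits.Ventures.PercRepro2.Induced
import Summits.Ventures.PercRepro2.Frontier
import Summits.Ventures.PercRepro2.ObsIndependence
import Summits.Ventures.PercRepro2.BHK
import Summits.Ventures.PercRepro2.BHKEvents
import Summits.Ventures.PercRepro2.OrderPreservation
import Summits.Ventures.PercRepro2.OrderPreservationDual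
import Summits.Ventures.PercRepro2.VdBKahn
import Summits.Ventures.PercRepro2.BHKAvoid
import Summits.Ventures.PercRepro2.R2PrimeThreeReduction
import Summits.Ventures.PercRepro2.YBridge
import Summits.Ventures.PercRepro2.Yu1Functionals
import Summits.Ventures.PercRepro2.Yu1Events

import Summits.Ventures.PercRepro2.Yu1

import Summits.Ventures.PercRepro2.LBSplit

import Summits.Ventures.PercRepro2.YDelta

import Summits.Ventures.PercRepro2.YCompanions

/-!
# The R-world order (blind cell PercRepro2, typer-1; lead 21:58Z: "the R-world order alone suffices
for the light side"). `Rorder := P(b ∈ C₁, R) ≤ P(b ∈ C₂, R)`, `R = {a₂, a₃ ∉ C₁}` — the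
conclusion of R10d on `R` (`order_on_R`: the labelling `P(b ↔ a₁) ≤ P(b ↔ a₂)` implies it).

* `LA_R`, `LB_R`, `Yu1Delta_R`: the census rows (L_A^R), (L_B^R), (Yu1Δ^R) = `Rorder → …`
  (strict strengthenings of `LA`, `LB`, `Yu1Delta` under the labelling: `LA_of_LA_R`,
  `Yu1Delta_of_Yu1Delta_R`). NEG-31: `LA`, `LA_R` are FALSE (witness c7_00514 satisfies `Rorder`);
  they stay as census rows, `LA_of_LA_R` / `Yu1Delta_of_LA_R` are not targets.
* The light-side theorems hold under `Rorder` alone — their proofs used the labelling only through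
  `order_on_R`: `yu1_cleared_R` ((Yu1)), `lb_light_R` ((L_B)), `LB_R_holds : LB_R` (closed),
  `WtD_of_Rorder` ((WtD)), `W_nonneg_R` (`0 ≤ W`), and `Yu1Delta_of_LA_R : Rorder → LA → Yu1Delta`.
-/

namespace Summit.Ventures.PercRepro2

open UnionCluster Yu1

section RWorld

variable {V : Type*} {E : Type*} [Fintype E] [DecidableEq E] [Fintype V] [DecidableEq V]
  {R : Type*} [Field R] [LinearOrder R] [IsStrictOrderedRing R]

/-- **The R-world order**: `P(b ∈ C₁, R) ≤ P(b ∈ C₂, R)`, `R = {a₂, a₃ ∉ C₁}`. -/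
def Rorder (p : E → R) (ends : E → Sym2 V) (a₁ a₂ a₃ b : V) : Prop :=
  prob p (connEvent ends a₁ b ∩ avoidAll ends a₁ {a₂, a₃}) ≤
    prob p (connEvent ends a₂ b ∩ avoidAll ends a₁ {a₂, a₃})

/-- The labelling implies the R-order (R10d on `R`, `order_on_R`). -/
theorem Rorder_of_order (p : E → R) (hp : IsProbVec p) (ends : E → Sym2 V) {a₁ a₂ a₃ b : V}
    (hord : prob p (connEvent ends a₁ b) ≤ prob p (connEvent ends a₂ b)) :
    Rorder p ends a₁ a₂ a₃ b :=
  order_on_R p hp ends (a₃ := a₃) hord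

/-- **(L_A^R)** (= `la_light_R`): the R-order implies (L_A). FALSE (NEG-31); kept as the census row. -/
def LA_R (p : E → R) (ends : E → Sym2 V) (o a₁ a₂ a₃ b : V) : Prop :=
  Rorder p ends a₁ a₂ a₃ b → LA p ends o a₁ a₂ a₃ b

/-- **(L_B^R)**: the R-order implies (L_B). -/
def LB_R (p : E → R) (ends : E → Sym2 V) (o a₁ a₂ a₃ b : V) : Prop :=
  Rorder p ends a₁ a₂ a₃ b → LB p ends o a₁ a₂ a₃ b

/-- **(Yu1Δ^R)**: the R-order implies (Yu1Δ). -/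
def Yu1Delta_R (p : E → R) (ends : E → Sym2 V) (o a₁ a₂ a₃ b : V) : Prop :=
  Rorder p ends a₁ a₂ a₃ b → Yu1Delta p ends o a₁ a₂ a₃ b

/-- `la_light ⇐ la_light_R ∧ R10d` (true implication; both sides FALSE by NEG-31). -/
theorem LA_of_LA_R (p : E → R) (hp : IsProbVec p) (ends : E → Sym2 V) {o a₁ a₂ a₃ b : V}
    (hord : prob p (connEvent ends a₁ b) ≤ prob p (connEvent ends a₂ b))
    (h : LA_R p ends o a₁ a₂ a₃ b) : LA p ends o a₁ a₂ a₃ b :=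
  h (Rorder_of_order p hp ends hord)

/-- `(Yu1Δ) ⇐ (Yu1Δ^R) ∧ R10d`. -/
theorem Yu1Delta_of_Yu1Delta_R (p : E → R) (hp : IsProbVec p) (ends : E → Sym2 V)
    {o a₁ a₂ a₃ b : V} (hord : prob p (connEvent ends a₁ b) ≤ prob p (connEvent ends a₂ b))
    (h : Yu1Delta_R p ends o a₁ a₂ a₃ b) : Yu1Delta p ends o a₁ a₂ a₃ b :=
  h (Rorder_of_order p hp ends hord)

/-- **(Yu1) under the R-order alone** (`lead 21:58Z`): `T_{l→h} · P(PD) ≤ P(PD, o ∈ C₁) · (M₂ + Δ_T)`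
assuming only `P(b ∈ C₁, R) ≤ P(b ∈ C₂, R)` (the proof of `yu1_cleared` used the labelling only there). -/
theorem yu1_cleared_R (p : E → R) (hp : IsProbVec p) (ends : E → Sym2 V) {o a₁ a₂ a₃ b : V}
    (hR : Rorder p ends a₁ a₂ a₃ b) :
    prob p (PDEvent ends a₁ a₂ a₃ ∩ connEvent ends a₁ o ∩ connEvent ends a₂ b) *
        prob p (PDEvent ends a₁ a₂ a₃) ≤
      prob p (PDEvent ends a₁ a₂ a₃ ∩ connEvent ends a₁ o) *
        (massM2 p ends a₁ a₂ a₃ b + deltaT p ends a₁ a₂ a₃ b) := by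
  -- `M₂ + Δ_T = N_h − r_b`
  have hMΔ : massM2 p ends a₁ a₂ a₃ b + deltaT p ends a₁ a₂ a₃ b =
      prob p (connEvent ends a₂ b ∩ avoidAll ends a₁ {a₂, a₃}) -
        prob p (connEvent ends a₁ b ∩ TEvent ends a₁ a₂ a₃) := by
    rw [Nh_eq p ends a₁ a₂ a₃ b]
    unfold deltaT
    ring
  -- the order on `R`, in tower form
  have s4 : prob p (connEvent ends a₁ b ∩ avoidAll ends a₁ {a₂, a₃}) ≤
      prob p (connEvent ends a₂ b ∩ avoidAll ends a₁ {a₂, a₃}) := hR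
  rw [tower_b, tower_N] at s4
  rw [hMΔ, tower_T, tower_PD, tower_PDo, tower_N, tower_r]
  -- Harris pointwise: `E[1_o q; R] ≤ E[1_o u β; R]`
  have s1 : expect p (fun ω => ind o (cluster ends ω a₁) * q p ends a₂ a₃ b (cluster ends ω a₁) *
      (avoidAll ends a₁ {a₂, a₃}).indicator 1 ω) ≤
      expect p (fun ω => ind o (cluster ends ω a₁) * u p ends a₂ a₃ (cluster ends ω a₁) *
        beta p ends a₂ b (cluster ends ω a₁) * (avoidAll ends a₁ {a₂, a₃}).indicator 1 ω) := by
    refine expect_mono hp fun ω => ?_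
    have hind : 0 ≤ (avoidAll ends a₁ {a₂, a₃}).indicator (1 : Config E → R) ω :=
      Set.indicator_apply_nonneg fun _ => zero_le_one
    have h1 := mul_le_mul_of_nonneg_left (q_le p hp ends a₂ a₃ b (cluster ends ω a₁))
      (ind_nonneg o (cluster ends ω a₁))
    calc ind o (cluster ends ω a₁) * q p ends a₂ a₃ b (cluster ends ω a₁) *
          (avoidAll ends a₁ {a₂, a₃}).indicator 1 ω
        ≤ ind o (cluster ends ω a₁) * (u p ends a₂ a₃ (cluster ends ω a₁) *
            beta p ends a₂ b (cluster ends ω a₁)) * (avoidAll ends a₁ {a₂, a₃}).indicator 1 ω :=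
          mul_le_mul_of_nonneg_right h1 hind
      _ = _ := by ring
  have h2 := bhk_step2 p hp ends o a₁ a₂ a₃ b
  have h3 := bhk_step3 p hp ends a₁ a₂ a₃ b
  -- `r_b = E[1_b; R] − E[1_b u; R]`
  have eRb : expect p (fun ω => ind b (cluster ends ω a₁) *
      (1 - u p ends a₂ a₃ (cluster ends ω a₁)) * (avoidAll ends a₁ {a₂, a₃}).indicator 1 ω) =
      expect p (fun ω => ind b (cluster ends ω a₁) * (avoidAll ends a₁ {a₂, a₃}).indicator 1 ω) -
      expect p (fun ω => ind b (cluster ends ω a₁) * u p ends a₂ a₃ (cluster ends ω a₁) *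
        (avoidAll ends a₁ {a₂, a₃}).indicator 1 ω) := by
    rw [← expect_sub]
    congr 1
    funext ω
    simp only [Pi.sub_apply]
    ring
  -- nonnegativity and `E[u; R] ≤ P(R)`
  have hind : ∀ ω, 0 ≤ (avoidAll ends a₁ {a₂, a₃}).indicator (1 : Config E → R) ω :=
    fun _ => Set.indicator_apply_nonneg fun _ => zero_le_one
  have hA : 0 ≤ expect p (fun ω => ind o (cluster ends ω a₁) * u p ends a₂ a₃ (cluster ends ω a₁) *
      (avoidAll ends a₁ {a₂, a₃}).indicator 1 ω) :=
    expect_nonneg hp fun ω => mul_nonneg (mul_nonneg (ind_nonneg o _) (u_nonneg p hp ends a₂ a₃ _))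
      (hind ω)
  have hU : 0 ≤ expect p (fun ω => u p ends a₂ a₃ (cluster ends ω a₁) *
      (avoidAll ends a₁ {a₂, a₃}).indicator 1 ω) :=
    expect_nonneg hp fun ω => mul_nonneg (u_nonneg p hp ends a₂ a₃ _) (hind ω)
  have hPR : 0 ≤ prob p (avoidAll ends a₁ {a₂, a₃}) := prob_nonneg hp _
  have hUPR : expect p (fun ω => u p ends a₂ a₃ (cluster ends ω a₁) *
      (avoidAll ends a₁ {a₂, a₃}).indicator 1 ω) ≤ prob p (avoidAll ends a₁ {a₂, a₃}) := by
    rw [prob_eq_expect_indicator]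
    exact expect_mono hp fun ω => mul_le_of_le_one_left (hind ω) (u_le_one p hp ends a₂ a₃ _)
  have key := chain_alg s1 h2 h3 eRb s4 hA hU hPR hUPR
  rcases hPR.lt_or_eq with hpos | hzero
  · exact le_of_mul_le_mul_right key hpos
  · -- `P(R) = 0`: every expectation against `1_R` vanishes
    have hz : ∀ g : Config E → R,
        expect p (fun ω => g ω * (avoidAll ends a₁ {a₂, a₃}).indicator 1 ω) = 0 :=
      fun g => expect_mul_indicator_eq_zero_of_null hp hzero.symm g
    simp only [hz, mul_zero, sub_zero, le_refl]

/-- **(L_B) under the R-order alone**: the proof of `lb_light` used the labelling only through R10d on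
`R`, i.e. through `Rorder`. -/
theorem lb_light_R (p : E → R) (hp : IsProbVec p) (ends : E → Sym2 V) {o a₁ a₂ a₃ b : V}
    (hR : Rorder p ends a₁ a₂ a₃ b) :
    (prob p (connEvent ends a₁ o ∩ connEvent ends a₂ b ∩ avoidAll ends a₁ {a₂, a₃}) -
        prob p (connEvent ends a₁ o ∩ connEvent ends a₁ b ∩ TEvent ends a₁ a₂ a₃)) *
      prob p (PDEvent ends a₁ a₂ a₃ ∩ connEvent ends a₁ b) ≤
    prob p (PDEvent ends a₁ a₂ a₃ ∩ connEvent ends a₁ o ∩ connEvent ends a₁ b) *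
      (massM2 p ends a₁ a₂ a₃ b + deltaT p ends a₁ a₂ a₃ b) := by
  -- names for the two constants of the weight
  set D' := prob p (PDEvent ends a₁ a₂ a₃ ∩ connEvent ends a₁ b) with hD'
  set Wt := massM2 p ends a₁ a₂ a₃ b + deltaT p ends a₁ a₂ a₃ b with hWt
  have hind : ∀ ω, 0 ≤ (avoidAll ends a₁ {a₂, a₃}).indicator (1 : Config E → R) ω :=
    fun _ => Set.indicator_apply_nonneg fun _ => zero_le_one
  -- `0 ≤ D′` and `D′ ≤ W` (R10d on `R`)
  have hD : 0 ≤ D' := prob_nonneg hp _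
  have hDW : D' ≤ Wt := by
    have s4 : prob p (connEvent ends a₁ b ∩ avoidAll ends a₁ {a₂, a₃}) ≤
      prob p (connEvent ends a₂ b ∩ avoidAll ends a₁ {a₂, a₃}) := hR
    rw [tower_b, tower_N] at s4
    have eB : expect p (fun ω => ind b (cluster ends ω a₁) *
        (avoidAll ends a₁ {a₂, a₃}).indicator 1 ω) =
        expect p (fun ω => ind b (cluster ends ω a₁) * (1 - u p ends a₂ a₃ (cluster ends ω a₁)) *
          (avoidAll ends a₁ {a₂, a₃}).indicator 1 ω) +
        expect p (fun ω => ind b (cluster ends ω a₁) * u p ends a₂ a₃ (cluster ends ω a₁) *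
          (avoidAll ends a₁ {a₂, a₃}).indicator 1 ω) := by
      rw [← expect_add]
      congr 1
      funext ω
      simp only [Pi.add_apply]
      ring
    rw [hWt, W_eq, hD', tower_PDo]
    linarith
  -- BHK 1.3 with `f = 1_o`, `F₂ = D′ − G`
  have hGanti := G_anti p hp ends a₂ a₃ b hD hDW
  have hF₂ : Monotone (fun S : Set V => D' - (D' * (beta p ends a₂ b S -
      ind b S * (1 - u p ends a₂ a₃ S)) - Wt * (ind b S * u p ends a₂ a₃ S))) :=
    fun S S' h => sub_le_sub_left (hGanti h) D'
  have hF₂0 : ∀ S : Set V, 0 ≤ D' - (D' * (beta p ends a₂ b S -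
      ind b S * (1 - u p ends a₂ a₃ S)) - Wt * (ind b S * u p ends a₂ a₃ S)) :=
    fun S => sub_nonneg.2 (G_le p hp ends a₂ a₃ b hD hDW S)
  have h := bhk_induced p hp ends a₁ (F₁ := (ind o : Set V → R)) (ind_mono o) hF₂ (ind_nonneg o)
    hF₂0 Finset.univ {a₂, a₃} {a₂, a₃} (Finset.subset_univ _) (Finset.subset_univ _)
  simp only [REvent_univ, Finset.inter_self, Finset.union_self, expect_clusterObs_univ,
    Pi.mul_apply] at h
  -- the two linear expansions
  have eG : expect p (fun ω => (D' - (D' * (beta p ends a₂ b (cluster ends ω a₁) -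
      ind b (cluster ends ω a₁) * (1 - u p ends a₂ a₃ (cluster ends ω a₁))) -
      Wt * (ind b (cluster ends ω a₁) * u p ends a₂ a₃ (cluster ends ω a₁)))) *
      (avoidAll ends a₁ {a₂, a₃}).indicator 1 ω) =
      D' * prob p (avoidAll ends a₁ {a₂, a₃}) := by
    have e1 : (fun ω => (D' - (D' * (beta p ends a₂ b (cluster ends ω a₁) -
        ind b (cluster ends ω a₁) * (1 - u p ends a₂ a₃ (cluster ends ω a₁))) -
        Wt * (ind b (cluster ends ω a₁) * u p ends a₂ a₃ (cluster ends ω a₁)))) *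
        (avoidAll ends a₁ {a₂, a₃}).indicator 1 ω) =
        (fun ω => D' * (avoidAll ends a₁ {a₂, a₃}).indicator 1 ω) -
        ((fun ω => D' * (beta p ends a₂ b (cluster ends ω a₁) *
            (avoidAll ends a₁ {a₂, a₃}).indicator 1 ω)) -
          (fun ω => D' * (ind b (cluster ends ω a₁) * (1 - u p ends a₂ a₃ (cluster ends ω a₁)) *
            (avoidAll ends a₁ {a₂, a₃}).indicator 1 ω))) +
        (fun ω => Wt * (ind b (cluster ends ω a₁) * u p ends a₂ a₃ (cluster ends ω a₁) *
            (avoidAll ends a₁ {a₂, a₃}).indicator 1 ω)) := by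
      funext ω
      simp only [Pi.add_apply, Pi.sub_apply]
      ring
    rw [e1, expect_add, expect_sub, expect_sub, expect_const_mul, expect_const_mul,
      expect_const_mul, expect_const_mul, ← prob_eq_expect_indicator, ← tower_PDo, ← hD']
    have hW : Wt = expect p (fun ω => beta p ends a₂ b (cluster ends ω a₁) *
        (avoidAll ends a₁ {a₂, a₃}).indicator 1 ω) -
        expect p (fun ω => ind b (cluster ends ω a₁) * (1 - u p ends a₂ a₃ (cluster ends ω a₁)) *
          (avoidAll ends a₁ {a₂, a₃}).indicator 1 ω) := by
      rw [hWt, W_eq]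
    rw [hW]
    ring
  have eoG : expect p (fun ω => ind o (cluster ends ω a₁) *
      (D' - (D' * (beta p ends a₂ b (cluster ends ω a₁) -
        ind b (cluster ends ω a₁) * (1 - u p ends a₂ a₃ (cluster ends ω a₁))) -
        Wt * (ind b (cluster ends ω a₁) * u p ends a₂ a₃ (cluster ends ω a₁)))) *
      (avoidAll ends a₁ {a₂, a₃}).indicator 1 ω) =
      D' * expect p (fun ω => ind o (cluster ends ω a₁) *
          (avoidAll ends a₁ {a₂, a₃}).indicator 1 ω) -
        (D' * (prob p (connEvent ends a₁ o ∩ connEvent ends a₂ b ∩ avoidAll ends a₁ {a₂, a₃}) -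
          prob p (connEvent ends a₁ o ∩ connEvent ends a₁ b ∩ TEvent ends a₁ a₂ a₃)) -
         Wt * prob p (PDEvent ends a₁ a₂ a₃ ∩ connEvent ends a₁ o ∩ connEvent ends a₁ b)) := by
    have e1 : (fun ω => ind o (cluster ends ω a₁) *
        (D' - (D' * (beta p ends a₂ b (cluster ends ω a₁) -
          ind b (cluster ends ω a₁) * (1 - u p ends a₂ a₃ (cluster ends ω a₁))) -
          Wt * (ind b (cluster ends ω a₁) * u p ends a₂ a₃ (cluster ends ω a₁)))) *
        (avoidAll ends a₁ {a₂, a₃}).indicator 1 ω) =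
        (fun ω => D' * (ind o (cluster ends ω a₁) * (avoidAll ends a₁ {a₂, a₃}).indicator 1 ω)) -
        ((fun ω => D' * (ind o (cluster ends ω a₁) * beta p ends a₂ b (cluster ends ω a₁) *
            (avoidAll ends a₁ {a₂, a₃}).indicator 1 ω)) -
          (fun ω => D' * (ind o (cluster ends ω a₁) * ind b (cluster ends ω a₁) *
            (1 - u p ends a₂ a₃ (cluster ends ω a₁)) *
            (avoidAll ends a₁ {a₂, a₃}).indicator 1 ω))) +
        (fun ω => Wt * (ind o (cluster ends ω a₁) * ind b (cluster ends ω a₁) *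
            u p ends a₂ a₃ (cluster ends ω a₁) * (avoidAll ends a₁ {a₂, a₃}).indicator 1 ω)) := by
      funext ω
      simp only [Pi.add_apply, Pi.sub_apply]
      ring
    rw [e1, expect_add, expect_sub, expect_sub, expect_const_mul, expect_const_mul,
      expect_const_mul, expect_const_mul, ← tower_ob, ← tower_obT, ← tower_PDob]
    ring
  rw [eG, eoG] at h
  -- `E[1_o G; R] · P(R) ≤ 0`, then cancel `P(R)`
  have hPR : 0 ≤ prob p (avoidAll ends a₁ {a₂, a₃}) := prob_nonneg hp _
  have key : (D' * (prob p (connEvent ends a₁ o ∩ connEvent ends a₂ b ∩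
      avoidAll ends a₁ {a₂, a₃}) -
      prob p (connEvent ends a₁ o ∩ connEvent ends a₁ b ∩ TEvent ends a₁ a₂ a₃)) -
      Wt * prob p (PDEvent ends a₁ a₂ a₃ ∩ connEvent ends a₁ o ∩ connEvent ends a₁ b)) *
      prob p (avoidAll ends a₁ {a₂, a₃}) ≤ 0 := by
    linarith [h]
  rcases hPR.lt_or_eq with hpos | hzero
  · have := nonpos_of_mul_nonpos_left key hpos
    linarith
  · -- `P(R) = 0`: every expectation against `1_R` vanishes
    have hz : ∀ g : Config E → R,
        expect p (fun ω => g ω * (avoidAll ends a₁ {a₂, a₃}).indicator 1 ω) = 0 :=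
      fun g => expect_mul_indicator_eq_zero_of_null hp hzero.symm g
    rw [tower_ob, tower_obT, hD', tower_PDo, tower_PDob, hz, hz, hz, hz]
    simp

/-- **(WtD) under the R-order alone** (the proof of `WtD_of_order` used the labelling only through
`Rorder`). -/
theorem WtD_of_Rorder (p : E → R) (hp : IsProbVec p) (ends : E → Sym2 V) {a₁ a₂ a₃ b : V}
    (hR : Rorder p ends a₁ a₂ a₃ b) :
    WtD p ends a₁ a₂ a₃ b := by
  unfold WtD
  -- the atoms: `Bb = E[1_b; R]`, `BbU = E[1_b u; R]`, `Uu = E[u; R]`, `B = E[β; R]`, `PR = P(R)`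
  have hind : ∀ ω, 0 ≤ (avoidAll ends a₁ {a₂, a₃}).indicator (1 : Config E → R) ω :=
    fun _ => Set.indicator_apply_nonneg fun _ => zero_le_one
  have s4 : prob p (connEvent ends a₁ b ∩ avoidAll ends a₁ {a₂, a₃}) ≤
      prob p (connEvent ends a₂ b ∩ avoidAll ends a₁ {a₂, a₃}) := hR
  rw [tower_b, tower_N] at s4
  have h3 := bhk_step3 p hp ends a₁ a₂ a₃ b
  have eRb : expect p (fun ω => ind b (cluster ends ω a₁) *
      (1 - u p ends a₂ a₃ (cluster ends ω a₁)) * (avoidAll ends a₁ {a₂, a₃}).indicator 1 ω) =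
      expect p (fun ω => ind b (cluster ends ω a₁) * (avoidAll ends a₁ {a₂, a₃}).indicator 1 ω) -
      expect p (fun ω => ind b (cluster ends ω a₁) * u p ends a₂ a₃ (cluster ends ω a₁) *
        (avoidAll ends a₁ {a₂, a₃}).indicator 1 ω) := by
    rw [← expect_sub]
    congr 1
    funext ω
    simp only [Pi.sub_apply]
    ring
  have eT : expect p (fun ω => (1 - u p ends a₂ a₃ (cluster ends ω a₁)) *
      (avoidAll ends a₁ {a₂, a₃}).indicator 1 ω) =
      prob p (avoidAll ends a₁ {a₂, a₃}) -
        expect p (fun ω => u p ends a₂ a₃ (cluster ends ω a₁) *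
          (avoidAll ends a₁ {a₂, a₃}).indicator 1 ω) := by
    rw [prob_eq_expect_indicator, ← expect_sub]
    congr 1
    funext ω
    simp only [Pi.sub_apply]
    ring
  -- the plain-event quantities in tower form
  have hRb : prob p (RbEvent ends a₁ a₂ a₃ b) = prob p (avoidAll ends a₁ {a₂, a₃}) -
      expect p (fun ω => ind b (cluster ends ω a₁) * (avoidAll ends a₁ {a₂, a₃}).indicator 1 ω) := by
    have h := prob_inter_add_prob_inter_compl p (avoidAll ends a₁ {a₂, a₃}) (connEvent ends a₁ b)
    rw [Set.inter_comm, tower_b] at h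
    unfold RbEvent
    linarith
  have hX : prob p (TEvent ends a₁ a₂ a₃ ∩ (connEvent ends a₁ b)ᶜ) =
      prob p (TEvent ends a₁ a₂ a₃) - prob p (connEvent ends a₁ b ∩ TEvent ends a₁ a₂ a₃) := by
    have h := prob_inter_add_prob_inter_compl p (TEvent ends a₁ a₂ a₃) (connEvent ends a₁ b)
    rw [Set.inter_comm] at h
    linarith
  have hPDb := prob_PD_add_T_notb p ends a₁ a₂ a₃ b
  have hW := W_eq p ends a₁ a₂ a₃ b
  rw [hW]
  rw [hRb, hX] at hPDb
  rw [hX, tower_T_only, eT, tower_r, eRb]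
  rw [tower_T_only, eT, tower_r, eRb] at hPDb
  have hX0 : 0 ≤ prob p (TEvent ends a₁ a₂ a₃ ∩ (connEvent ends a₁ b)ᶜ) := prob_nonneg hp _
  rw [hX, tower_T_only, eT, tower_r, eRb] at hX0
  have hPR : 0 ≤ prob p (avoidAll ends a₁ {a₂, a₃}) := prob_nonneg hp _
  have key := wtd_alg s4 h3 hX0 hPR
  -- `P(PD, b ∉ C₁) = P(R_b) − X`
  have hPD' : prob p (PDEvent ends a₁ a₂ a₃ ∩ (connEvent ends a₁ b)ᶜ) =
      (prob p (avoidAll ends a₁ {a₂, a₃}) -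
        expect p (fun ω => ind b (cluster ends ω a₁) * (avoidAll ends a₁ {a₂, a₃}).indicator 1 ω)) -
      (prob p (avoidAll ends a₁ {a₂, a₃}) -
          expect p (fun ω => u p ends a₂ a₃ (cluster ends ω a₁) *
            (avoidAll ends a₁ {a₂, a₃}).indicator 1 ω) -
        (expect p (fun ω => ind b (cluster ends ω a₁) *
            (avoidAll ends a₁ {a₂, a₃}).indicator 1 ω) -
          expect p (fun ω => ind b (cluster ends ω a₁) * u p ends a₂ a₃ (cluster ends ω a₁) *
            (avoidAll ends a₁ {a₂, a₃}).indicator 1 ω))) := by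
    linarith
  rw [hPD']
  rcases hPR.lt_or_eq with hpos | hzero
  · exact le_of_mul_le_mul_right key hpos
  · have hz : ∀ g : Config E → R,
        expect p (fun ω => g ω * (avoidAll ends a₁ {a₂, a₃}).indicator 1 ω) = 0 :=
      fun g => expect_mul_indicator_eq_zero_of_null hp hzero.symm g
    simp [hz, ← hzero]

/-- **(L_B^R) holds** (closed): `LB_R`. -/
theorem LB_R_holds (p : E → R) (hp : IsProbVec p) (ends : E → Sym2 V) (o a₁ a₂ a₃ b : V) :
    LB_R p ends o a₁ a₂ a₃ b := by
  intro hR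
  unfold LB
  rw [Tlh_sub_deltaL]
  exact lb_light_R p hp ends hR

/-- `0 ≤ W = M₂ + Δ_T` under the R-order alone. -/
theorem W_nonneg_R (p : E → R) (hp : IsProbVec p) (ends : E → Sym2 V) {a₁ a₂ a₃ b : V}
    (hR : Rorder p ends a₁ a₂ a₃ b) :
    0 ≤ massM2 p ends a₁ a₂ a₃ b + deltaT p ends a₁ a₂ a₃ b := by
  have s4 : prob p (connEvent ends a₁ b ∩ avoidAll ends a₁ {a₂, a₃}) ≤
      prob p (connEvent ends a₂ b ∩ avoidAll ends a₁ {a₂, a₃}) := hR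
  rw [tower_b, tower_N] at s4
  rw [W_eq]
  have e : expect p (fun ω => ind b (cluster ends ω a₁) * (1 - u p ends a₂ a₃ (cluster ends ω a₁)) *
      (avoidAll ends a₁ {a₂, a₃}).indicator 1 ω) ≤
      expect p (fun ω => ind b (cluster ends ω a₁) * (avoidAll ends a₁ {a₂, a₃}).indicator 1 ω) := by
    refine expect_mono hp fun ω => ?_
    have h1 : (0 : R) ≤ ind b (cluster ends ω a₁) := ind_nonneg b _
    have h2 : 0 ≤ (avoidAll ends a₁ {a₂, a₃}).indicator (1 : Config E → R) ω :=
      Set.indicator_apply_nonneg fun _ => zero_le_one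
    have h3 := u_nonneg p hp ends a₂ a₃ (cluster ends ω a₁)
    have h4 := u_le_one p hp ends a₂ a₃ (cluster ends ω a₁)
    calc ind b (cluster ends ω a₁) * (1 - u p ends a₂ a₃ (cluster ends ω a₁)) *
          (avoidAll ends a₁ {a₂, a₃}).indicator 1 ω
        ≤ ind b (cluster ends ω a₁) * 1 * (avoidAll ends a₁ {a₂, a₃}).indicator 1 ω :=
          mul_le_mul_of_nonneg_right (mul_le_mul_of_nonneg_left (by linarith) h1) h2
      _ = _ := by ring
  linarith

/-- `(Yu1Δ) ⇐ (L_A)` under the R-order alone. -/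
theorem Yu1Delta_of_LA_R (p : E → R) (hp : IsProbVec p) (ends : E → Sym2 V) {o a₁ a₂ a₃ b : V}
    (hR : Rorder p ends a₁ a₂ a₃ b) (hA : LA p ends o a₁ a₂ a₃ b) :
    Yu1Delta p ends o a₁ a₂ a₃ b :=
  Yu1Delta_of_LA_LB p ends hA (LB_R_holds p hp ends o a₁ a₂ a₃ b hR)

end RWorld

end Summit.Ventures.PercRepro2
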